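import Summits.AnomalousDissipation.AnomalousDissipation.Theorems.SawtoothPulseCascadeK1LocalisedCascadePhaseTwoStartBoxStrip
import Summits.AnomalousDissipation.AnomalousDissipation.Theorems.SawtoothPulseCascadeK1LocalisedCascadePhaseTwoStartBoxSeries20
import Mathlib.Analysis.Real.Pi.Bounds

/-!
# K1loc, line `Spectral` / thin start — helper: PHASE-TWO START BOX VI — `S_1(20) ≤ 8/625` and the start box at strip `20`

Helper file of the prover lane on the crux `K1LocalisedCascade` (stmt-AnomalousDissipation-19491), route `SawtoothPulseCascade`
(glue seat; start box of record `StartBoxTwo`; arbiter A23-13 (1): `E_2 ≤ 0.05` with first-order corner-trace dischargers).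
Twin of `…PhaseTwoStartBox` with the `a₁`-strip widened from `12` to `20`, the threshold from which every `a₁`-fibre has its
H-lobe above the low-fibre window `K′ = 130` (sizing memo `CT-PHASE1-SIZING-k1locp3g4.md`): the fibres `12 ≤ |k₀| < 20`
(truth `0.0015`, three quarters of the phase-1 T-H junk) are absorbed into the strip instead of a separate annulus file.
* `strip20_const_le`, **`phaseOne_strip20_le`**: `γ = 8`, `N₀ = 1`, `0 < δ₀ ≤ 2⁻³⁰` ⇒ `Σ'[|k₀| < 20]‖𝓕a₁‖² ≤ 8/625 = 0.0128`
  (series `31/10000` of `…PhaseTwoStartBoxSeries20`; truth `0.0091`).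
* **`phaseTwo_start_le_of_strip`**: the box with the strip bound itself as a hypothesis (any threshold `K`, any constant `c`):
  (hK) `Σ'[|k₀| < K]‖𝓕a₁‖² ≤ c`, (hT) `Σ'[|k₁| < K′]‖𝓕b₁‖² ≤ Σ'[|k₀| < K]‖𝓕a₁‖² + j_H`, (hS), (hO) as in `phaseTwo_start_le`
  ⇒ `S_2(800) + O_2(800) ≤ c + j_H + j_V + j_O`; instance **`phaseTwo_start20_le`** (`K = 20`, `c = 8/625`).
No definitions; nothing about the crux at `δ₀ = ¼`. [cite: Grafakos2014, Prop. 3.1.2 (5) and Prop. 3.2.7 (3)] [problem: turb]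
-/

-- `Summit.<Summit>.<Problem>`: single-conjunct summit, the duplicate namespace segment is deliberate.
set_option linter.dupNamespace false

noncomputable section

namespace Summit.AnomalousDissipation.AnomalousDissipation.Theorems.SawtoothPulseCascade.K1Start

open MeasureTheory Set Filter Topology UnitAddTorus Function Complex AddCircle
open scoped Real
open Literature.Analysis Literature.Analysis.FunctionSpaces Literature.Analysis.FunctionSpaces.Torus Literature.Analysis.FluidPDE
open Literature.Analysis.FluidPDE.ShearStage
open Literature.Analysis.FluidPDE.SawtoothCascade Literature.Analysis.FluidPDE.SawtoothCascade.CascadeParams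

/-! ## §1 The numeric value of the strip bound -/

/-- `(16/(63π) + 2⁻²⁵)² + (2⁻²⁵)²/2 + (√(2·31/10000) + 2⁻²⁵)² ≤ 8/625` (`π > 3.1415`). [folklore] -/
theorem strip20_const_le :
    (16 / (63 * π) + (2 : ℝ)⁻¹ ^ 25) ^ 2 + ((2 : ℝ)⁻¹ ^ 25) ^ 2 / 2 + (Real.sqrt (2 * (31 / 10000)) + (2 : ℝ)⁻¹ ^ 25) ^ 2 ≤
      8 / 625 := by
  have hπ : 3.1415 < π := Real.pi_gt_d4
  have hπ0 : 0 < π := Real.pi_pos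
  -- `16/(63π) ≤ 0.080856`
  have h1 : 16 / (63 * π) ≤ 0.080856 := by
    rw [div_le_iff₀ (by positivity)]; nlinarith
  have h10 : 0 ≤ 16 / (63 * π) := by positivity
  -- `√(62/10000) ≤ 0.078741`
  have h2 : Real.sqrt (2 * (31 / 10000)) ≤ 0.078741 := by
    rw [Real.sqrt_le_left (by norm_num)]; norm_num
  have h20 : 0 ≤ Real.sqrt (2 * (31 / 10000)) := Real.sqrt_nonneg _
  have hε : ((2 : ℝ)⁻¹ ^ 25) ≤ 0.0000001 := by norm_num
  have hε0 : (0 : ℝ) ≤ (2 : ℝ)⁻¹ ^ 25 := by positivity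
  have hA : (16 / (63 * π) + (2 : ℝ)⁻¹ ^ 25) ^ 2 ≤ (0.080856 + 0.0000001) ^ 2 :=
    pow_le_pow_left₀ (by positivity) (add_le_add h1 hε) 2
  have hB : (Real.sqrt (2 * (31 / 10000)) + (2 : ℝ)⁻¹ ^ 25) ^ 2 ≤ (0.078741 + 0.0000001) ^ 2 :=
    pow_le_pow_left₀ (by positivity) (add_le_add h2 hε) 2
  have hC : ((2 : ℝ)⁻¹ ^ 25) ^ 2 / 2 ≤ (0.0000001 : ℝ) ^ 2 / 2 :=
    div_le_div_of_nonneg_right (pow_le_pow_left₀ hε0 hε 2) (by norm_num)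
  have : (0.080856 + 0.0000001 : ℝ) ^ 2 + (0.0000001 : ℝ) ^ 2 / 2 + (0.078741 + 0.0000001) ^ 2 ≤ 8 / 625 := by norm_num
  linarith

section Cascade

variable (P : CascadeParams)

/-- **THE STRIP OF `a₁` AT `K = 20`, CERTIFIED**: `γ = 8`, `N₀ = 1`, `0 < δ₀ ≤ 2⁻³⁰` ⇒ `Σ'[|k₀| < 20]‖𝓕a₁‖² ≤ 8/625`
(`= 0.0256·‖datum‖²`; truth `0.0182·‖datum‖²`). [cite: Grafakos2014, Prop. 3.1.2 (5) and Prop. 3.2.7 (3)] -/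
theorem phaseOne_strip20_le (hγ : P.γ = 8) (hN₀ : P.N₀ = 1) (hδ₀ : 0 < P.δ₀) (hδ₀' : P.δ₀ ≤ (2 : ℝ)⁻¹ ^ 30) (hd : 0 < P.d)
    (a b : ℕ → UnitAddTorus (Fin 2) → ℝ) (h0 : a 0 = datum)
    (hb : b 0 = a 0 ∘ shearMap 0 1 (amp ⟨P.U 0, P.U_periodic 0, P.contDiff_U (P.δ_pos hδ₀ hd 0)⟩ P.γ))
    (hab : a 1 = b 0 ∘ shearMap 1 0 (amp ⟨P.U 0, P.U_periodic 0, P.contDiff_U (P.δ_pos hδ₀ hd 0)⟩ P.γ)) :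
    ∑' k : Fin 2 → ℤ, (if |k 0| < ((20 : ℕ) : ℤ) then (1 : ℝ) else 0) * ‖mFourierCoeff (fun x => (a 1 x : ℂ)) k‖ ^ 2 ≤
      8 / 625 := by
  have h := phaseOne_strip_le_of_series P hγ hN₀ hδ₀ hδ₀' hd a b h0 hb hab 20 (B := 31 / 10000)
    (fun ε hε0 hε T => sum_strip20_series_le hε0 hε T)
  exact h.trans strip20_const_le

/-! ## §2 The start box, strip bound as a hypothesis; the instance at `K = 20` -/

/-- **THE PHASE-TWO START BOX WITH THE STRIP AS A HYPOTHESIS**: for any strip threshold `K`, any constant `c` with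
(hK) `Σ'[|k₀| < K]‖𝓕a₁‖² ≤ c`, and the three phase-1 half-step hypotheses (hT) (low fibres `|k₁| < K′` of `b₁` from the strip up to
`j_H`), (hS) (strip `|k₀| < 800` of `a₂` from those fibres up to `j_V`), (hO) (off-cone class of `a₂` at `800`, slope `(1,4)`,
at most `j_O`): `S_2(800) + O_2(800) ≤ c + j_H + j_V + j_O`. [cite: Grafakos2014, Prop. 3.2.7 (3)] -/
theorem phaseTwo_start_le_of_strip (a b : ℕ → UnitAddTorus (Fin 2) → ℝ) (K K' : ℕ) {c jH jV jO : ℝ}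
    (hK : ∑' k : Fin 2 → ℤ, (if |k 0| < (K : ℤ) then (1 : ℝ) else 0) * ‖mFourierCoeff (fun x => (a 1 x : ℂ)) k‖ ^ 2 ≤ c)
    (hT : ∑' k : Fin 2 → ℤ, (if |k 1| < (K' : ℤ) then (1 : ℝ) else 0) * ‖mFourierCoeff (fun x => (b 1 x : ℂ)) k‖ ^ 2 ≤
      ∑' k : Fin 2 → ℤ, (if |k 0| < (K : ℤ) then (1 : ℝ) else 0) * ‖mFourierCoeff (fun x => (a 1 x : ℂ)) k‖ ^ 2 + jH)
    (hS : ∑' k : Fin 2 → ℤ, (if |k 0| < ((800 : ℕ) : ℤ) then (1 : ℝ) else 0) * ‖mFourierCoeff (fun x => (a 2 x : ℂ)) k‖ ^ 2 ≤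
      ∑' k : Fin 2 → ℤ, (if |k 1| < (K' : ℤ) then (1 : ℝ) else 0) * ‖mFourierCoeff (fun x => (b 1 x : ℂ)) k‖ ^ 2 + jV)
    (hO : ∑' k : Fin 2 → ℤ, (if ((800 : ℕ) : ℤ) ≤ |k 0| ∧ ((1 : ℕ) : ℤ) * |k 0| ≤ ((4 : ℕ) : ℤ) * |k 1| then (1 : ℝ) else 0) *
      ‖mFourierCoeff (fun x => (a 2 x : ℂ)) k‖ ^ 2 ≤ jO) :
    ∑' k : Fin 2 → ℤ, (if |k 0| < ((800 : ℕ) : ℤ) then (1 : ℝ) else 0) * ‖mFourierCoeff (fun x => (a 2 x : ℂ)) k‖ ^ 2 +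
        ∑' k : Fin 2 → ℤ, (if ((800 : ℕ) : ℤ) ≤ |k 0| ∧ ((1 : ℕ) : ℤ) * |k 0| ≤ ((4 : ℕ) : ℤ) * |k 1| then (1 : ℝ) else 0) *
          ‖mFourierCoeff (fun x => (a 2 x : ℂ)) k‖ ^ 2 ≤
      c + jH + jV + jO := by
  set X := ∑' k : Fin 2 → ℤ, (if |k 0| < ((800 : ℕ) : ℤ) then (1 : ℝ) else 0) * ‖mFourierCoeff (fun x => (a 2 x : ℂ)) k‖ ^ 2
    with hX
  set Y := ∑' k : Fin 2 → ℤ, (if ((800 : ℕ) : ℤ) ≤ |k 0| ∧ ((1 : ℕ) : ℤ) * |k 0| ≤ ((4 : ℕ) : ℤ) * |k 1| then (1 : ℝ) else 0) *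
      ‖mFourierCoeff (fun x => (a 2 x : ℂ)) k‖ ^ 2 with hY
  set T := ∑' k : Fin 2 → ℤ, (if |k 1| < (K' : ℤ) then (1 : ℝ) else 0) * ‖mFourierCoeff (fun x => (b 1 x : ℂ)) k‖ ^ 2 with hT'
  set S := ∑' k : Fin 2 → ℤ, (if |k 0| < (K : ℤ) then (1 : ℝ) else 0) * ‖mFourierCoeff (fun x => (a 1 x : ℂ)) k‖ ^ 2
    with hS'
  have e1 : X + Y ≤ (T + jV) + jO := add_le_add hS hO
  linarith

/-- **THE PHASE-TWO START BOX AT STRIP `20`** (`StartBoxTwo`, `K_2 = 800`, A23-13 (1)): `γ = 8`, `N₀ = 1`, `0 < δ₀ ≤ 2⁻³⁰`,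
(hT)/(hS)/(hO) the phase-1 half-step hypotheses with the `a₁`-strip at `|k₀| < 20` ⇒
`S_2(800) + O_2(800) ≤ 8/625 + j_H + j_V + j_O` (truths: `S_1(20) = 0.0091`, `j_H ≈ 3.5·10⁻⁴`, `j_V ≈ 4·10⁻⁵`, `j_O ≈ 6·10⁻⁵`).
[cite: Grafakos2014, Prop. 3.1.2 (5) and Prop. 3.2.7 (3)] -/
theorem phaseTwo_start20_le (hγ : P.γ = 8) (hN₀ : P.N₀ = 1) (hδ₀ : 0 < P.δ₀) (hδ₀' : P.δ₀ ≤ (2 : ℝ)⁻¹ ^ 30) (hd : 0 < P.d)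
    (a b : ℕ → UnitAddTorus (Fin 2) → ℝ) (h0 : a 0 = datum)
    (hb : ∀ j, b j = a j ∘ shearMap 0 1 (amp ⟨P.U j, P.U_periodic j, P.contDiff_U (P.δ_pos hδ₀ hd j)⟩ P.γ))
    (hab : ∀ j, a (j + 1) = b j ∘ shearMap 1 0 (amp ⟨P.U j, P.U_periodic j, P.contDiff_U (P.δ_pos hδ₀ hd j)⟩ P.γ))
    (K' : ℕ) {jH jV jO : ℝ}
    (hT : ∑' k : Fin 2 → ℤ, (if |k 1| < (K' : ℤ) then (1 : ℝ) else 0) * ‖mFourierCoeff (fun x => (b 1 x : ℂ)) k‖ ^ 2 ≤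
      ∑' k : Fin 2 → ℤ, (if |k 0| < ((20 : ℕ) : ℤ) then (1 : ℝ) else 0) * ‖mFourierCoeff (fun x => (a 1 x : ℂ)) k‖ ^ 2 + jH)
    (hS : ∑' k : Fin 2 → ℤ, (if |k 0| < ((800 : ℕ) : ℤ) then (1 : ℝ) else 0) * ‖mFourierCoeff (fun x => (a 2 x : ℂ)) k‖ ^ 2 ≤
      ∑' k : Fin 2 → ℤ, (if |k 1| < (K' : ℤ) then (1 : ℝ) else 0) * ‖mFourierCoeff (fun x => (b 1 x : ℂ)) k‖ ^ 2 + jV)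
    (hO : ∑' k : Fin 2 → ℤ, (if ((800 : ℕ) : ℤ) ≤ |k 0| ∧ ((1 : ℕ) : ℤ) * |k 0| ≤ ((4 : ℕ) : ℤ) * |k 1| then (1 : ℝ) else 0) *
      ‖mFourierCoeff (fun x => (a 2 x : ℂ)) k‖ ^ 2 ≤ jO) :
    ∑' k : Fin 2 → ℤ, (if |k 0| < ((800 : ℕ) : ℤ) then (1 : ℝ) else 0) * ‖mFourierCoeff (fun x => (a 2 x : ℂ)) k‖ ^ 2 +
        ∑' k : Fin 2 → ℤ, (if ((800 : ℕ) : ℤ) ≤ |k 0| ∧ ((1 : ℕ) : ℤ) * |k 0| ≤ ((4 : ℕ) : ℤ) * |k 1| then (1 : ℝ) else 0) *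
          ‖mFourierCoeff (fun x => (a 2 x : ℂ)) k‖ ^ 2 ≤
      8 / 625 + jH + jV + jO :=
  phaseTwo_start_le_of_strip a b 20 K' (phaseOne_strip20_le P hγ hN₀ hδ₀ hδ₀' hd a b h0 (hb 0) (hab 0)) hT hS hO

end Cascade

end Summit.AnomalousDissipation.AnomalousDissipation.Theorems.SawtoothPulseCascade.K1Start
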